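import Summits.CriticalPhenomena.PercolationContinuityZ3.Theorems.PercNearOneGluingNoHeavyLowerTailMergeStability
import HarnessLib

/-!
# `NoHeavyLowerTail` (stmt-CriticalPhenomena-4575) — the COVARIANCE ISOLATION LEMMA (GU) implies the cumulative
# isolation lemma at every level, hence the crux

Support file (prover `prim-lf-7`, lemma factory "k-cluster conditional association"; `--supports stmt-CriticalPhenomena-4575`).
No definitions, no named facts, no sorries.

Bond percolation `μ = prodBernoulli w` on `Fin n`, relays `A`, observer `o ∉ A`, level `j`; `π(v) = {x ∈ A : v ↔ x}`, `N = |π(o)|`,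
`r_a = μ(|π(a)| ≤ j)`.  Order the relays WORST FIRST — by decreasing `r`, index as tie-break — and let `J` be the worst-first top
of `o`'s pocket: `J = a` iff `a ∈ π(o)` and `a` beats every `b ∈ π(o)` (`r_a > r_b`, or `r_a = r_b ∧ a ≤ b`).

**Covariance isolation lemma (GU; hypothesis `hCovIL` below — the giant version of the covariance-gluing inequality (U) of
`Theorems/…CovarianceGluing.lean`; conjecture, census prim-lf-7 / ttrl `lf7`: 0 violations in 13 574 exact laws at (5,2) incl.
every 6-vertex support and all tie orders; numerically the SHARPEST of the three normal forms GU / XZ = CST / GTP).**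

   `μ(1 ≤ N ≤ j) ≤ Σ_{a ∈ A} μ(J = a) · r_a`       (equivalently `Σ_a Cov(1{J = a}, 1{|π(a)| ≥ j+1}) ≥ 0` on the ladder,
                                                    or: for an independent copy `ω'`, `P(J(ω) heavy in ω') ≤ P(J(ω) heavy in ω)`).

* `cumulativeIsolation_of_covIL` — GU (all levels) ⇒ `stub_cumulativeIsolation` (all levels): `Σ_a μ(J=a) r_a ≤ (max_a r_a)·μ(N ≥ 1) ≤ r_{a⋆}`
  for a champion `a⋆`, since the events `{J = a}` partition `{N ≥ 1}`.
* `noHeavyLowerTail_of_covIL` — hence GU closes the crux (`Theorems.noHeavyLowerTail_of_stub_cumulativeIsolation`).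
-/

noncomputable section

namespace Summit.CriticalPhenomena.PercolationContinuityZ3.Theorems

open MeasureTheory Set Literature.Probability.LatticeModels Literature.Probability.Percolation
open scoped Classical BigOperators

variable {n : ℕ}

namespace CovarianceIsolation

/-- The worst-first top is unique: two relays that beat each other coincide. [folklore] -/
theorem top_unique {r : Fin n → ℝ} {a b : Fin n} (hab : r a > r b ∨ (r a = r b ∧ a ≤ b))
    (hba : r b > r a ∨ (r b = r a ∧ b ≤ a)) : a = b := by
  rcases hab with h1 | ⟨h1, h2⟩ <;> rcases hba with h3 | ⟨h3, h4⟩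
  · exact absurd h1 (not_lt.2 h3.le)
  · exact absurd h1 (by rw [h3]; exact lt_irrefl _)
  · exact absurd h3 (by rw [h1]; exact lt_irrefl _)
  · exact le_antisymm h2 h4

/-- A nonempty finite set of relays has a worst-first top. [folklore] -/
theorem exists_top (r : Fin n → ℝ) (P : Finset (Fin n)) (hP : P.Nonempty) :
    ∃ a ∈ P, ∀ b ∈ P, r a > r b ∨ (r a = r b ∧ a ≤ b) := by
  obtain ⟨m, hm, hmax⟩ := Finset.exists_max_image P r hP
  set Q := P.filter fun b => r b = r m with hQ
  have hQne : Q.Nonempty := ⟨m, Finset.mem_filter.2 ⟨hm, rfl⟩⟩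
  refine ⟨Q.min' hQne, (Finset.mem_filter.1 (Finset.min'_mem Q hQne)).1, fun b hb => ?_⟩
  have hra : r (Q.min' hQne) = r m := (Finset.mem_filter.1 (Finset.min'_mem Q hQne)).2
  rcases (hmax b hb).lt_or_eq with hlt | heq
  · exact Or.inl (by rw [hra]; exact hlt)
  · exact Or.inr ⟨by rw [hra, heq], Finset.min'_le Q b (Finset.mem_filter.2 ⟨hb, heq⟩)⟩

end CovarianceIsolation

open CovarianceIsolation

/-- **GU ⇒ CIL (all levels).**  The covariance isolation lemma `μ(1 ≤ N ≤ j) ≤ Σ_a μ(J = a)·μ(|π(a)| ≤ j)` (worst-first top `J` of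
`o`'s pocket, index tie-break) implies the cumulative isolation lemma `∃ a ∈ A, μ(1 ≤ N ≤ j) ≤ μ(|π(a)| ≤ j)` — the registered stub
`stub_cumulativeIsolation` verbatim — with the champion as witness. [this file] -/
theorem cumulativeIsolation_of_covIL
    (hCovIL : ∀ (n : ℕ) (w : Sym2 (Fin n) → unitInterval) (A : Finset (Fin n)) (o : Fin n) (j : ℕ), o ∉ A →
      (prodBernoulli w).real {ω : BondConfig (Fin n) |
          1 ≤ (A.filter fun x => ω ∈ openConn o x).card ∧ (A.filter fun x => ω ∈ openConn o x).card ≤ j} ≤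
        ∑ a ∈ A, (prodBernoulli w).real {ω : BondConfig (Fin n) | a ∈ (A.filter fun x => ω ∈ openConn o x) ∧
            ∀ b ∈ (A.filter fun x => ω ∈ openConn o x),
              (prodBernoulli w).real {ω' : BondConfig (Fin n) | (A.filter fun x => ω' ∈ openConn a x).card ≤ j} >
                  (prodBernoulli w).real {ω' : BondConfig (Fin n) | (A.filter fun x => ω' ∈ openConn b x).card ≤ j} ∨
                ((prodBernoulli w).real {ω' : BondConfig (Fin n) | (A.filter fun x => ω' ∈ openConn a x).card ≤ j} =
                    (prodBernoulli w).real {ω' : BondConfig (Fin n) | (A.filter fun x => ω' ∈ openConn b x).card ≤ j} ∧ a ≤ b)} *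
          (prodBernoulli w).real {ω : BondConfig (Fin n) | (A.filter fun x => ω ∈ openConn a x).card ≤ j})
    (n : ℕ) (w : Sym2 (Fin n) → unitInterval) (A : Finset (Fin n)) (o : Fin n) (j : ℕ)
    (hA : A.Nonempty) (ho : o ∉ A) :
    ∃ a ∈ A,
      (prodBernoulli w).real {ω : BondConfig (Fin n) |
          1 ≤ (A.filter fun x => ω ∈ openConn o x).card ∧ (A.filter fun x => ω ∈ openConn o x).card ≤ j} ≤
        (prodBernoulli w).real {ω : BondConfig (Fin n) | (A.filter fun x => ω ∈ openConn a x).card ≤ j} := by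
  set μ := prodBernoulli w with hμ
  -- lightness rates and the champion
  set r : Fin n → ℝ := fun a => μ.real {ω : BondConfig (Fin n) | (A.filter fun x => ω ∈ openConn a x).card ≤ j} with hr
  obtain ⟨q, hq, hchamp⟩ := MergeStability.exists_champion μ A hA j
  refine ⟨q, hq, ?_⟩
  -- the top events
  set E : Fin n → Set (BondConfig (Fin n)) := fun a => {ω | a ∈ (A.filter fun x => ω ∈ openConn o x) ∧
      ∀ b ∈ (A.filter fun x => ω ∈ openConn o x), r a > r b ∨ (r a = r b ∧ a ≤ b)} with hE
  have key := hCovIL n w A o j ho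
  change μ.real _ ≤ ∑ a ∈ A, μ.real (E a) * r a at key
  -- Σ_a μ(E a) r_a ≤ r_q Σ_a μ(E a)
  have h1 : ∑ a ∈ A, μ.real (E a) * r a ≤ ∑ a ∈ A, μ.real (E a) * r q :=
    Finset.sum_le_sum fun a ha => mul_le_mul_of_nonneg_left (hchamp a ha) measureReal_nonneg
  -- the events E a, a ∈ A, are pairwise disjoint and contained in {N ≥ 1}; so Σ_a μ(E a) ≤ 1
  have hdisj : (↑A : Set (Fin n)).PairwiseDisjoint E := by
    intro a _ b _ hab
    rw [Function.onFun, Set.disjoint_left]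
    intro ω ha hb
    exact hab (top_unique (ha.2 b hb.1) (hb.2 a ha.1))
  have h2 : ∑ a ∈ A, μ.real (E a) = μ.real (⋃ a ∈ A, E a) :=
    (measureReal_biUnion_finset hdisj (fun _ _ => MeasurableSet.of_discrete)).symm
  have h3 : μ.real (⋃ a ∈ A, E a) ≤ 1 := by
    calc μ.real (⋃ a ∈ A, E a) ≤ μ.real (univ : Set (BondConfig (Fin n))) := measureReal_mono (subset_univ _) (measure_ne_top _ _)
      _ = 1 := probReal_univ
  have hrq : 0 ≤ r q := measureReal_nonneg
  calc μ.real {ω : BondConfig (Fin n) |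
          1 ≤ (A.filter fun x => ω ∈ openConn o x).card ∧ (A.filter fun x => ω ∈ openConn o x).card ≤ j}
        ≤ ∑ a ∈ A, μ.real (E a) * r a := key
    _ ≤ ∑ a ∈ A, μ.real (E a) * r q := h1
    _ = (∑ a ∈ A, μ.real (E a)) * r q := by rw [Finset.sum_mul]
    _ ≤ 1 * r q := by rw [h2]; exact mul_le_mul_of_nonneg_right h3 hrq
    _ = r q := one_mul _

/-- **GU closes the crux.**  The covariance isolation lemma (all levels) implies `NoHeavyLowerTail`, via
`cumulativeIsolation_of_covIL` and `Theorems.noHeavyLowerTail_of_stub_cumulativeIsolation`. [this file] -/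
theorem noHeavyLowerTail_of_covIL
    (hCovIL : ∀ (n : ℕ) (w : Sym2 (Fin n) → unitInterval) (A : Finset (Fin n)) (o : Fin n) (j : ℕ), o ∉ A →
      (prodBernoulli w).real {ω : BondConfig (Fin n) |
          1 ≤ (A.filter fun x => ω ∈ openConn o x).card ∧ (A.filter fun x => ω ∈ openConn o x).card ≤ j} ≤
        ∑ a ∈ A, (prodBernoulli w).real {ω : BondConfig (Fin n) | a ∈ (A.filter fun x => ω ∈ openConn o x) ∧
            ∀ b ∈ (A.filter fun x => ω ∈ openConn o x),
              (prodBernoulli w).real {ω' : BondConfig (Fin n) | (A.filter fun x => ω' ∈ openConn a x).card ≤ j} >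
                  (prodBernoulli w).real {ω' : BondConfig (Fin n) | (A.filter fun x => ω' ∈ openConn b x).card ≤ j} ∨
                ((prodBernoulli w).real {ω' : BondConfig (Fin n) | (A.filter fun x => ω' ∈ openConn a x).card ≤ j} =
                    (prodBernoulli w).real {ω' : BondConfig (Fin n) | (A.filter fun x => ω' ∈ openConn b x).card ≤ j} ∧ a ≤ b)} *
          (prodBernoulli w).real {ω : BondConfig (Fin n) | (A.filter fun x => ω ∈ openConn a x).card ≤ j}) :
    Summit.CriticalPhenomena.PercolationContinuityZ3.Theses.PercNearOneGluing.NoHeavyLowerTail :=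
  noHeavyLowerTail_of_stub_cumulativeIsolation fun n w A o j hA ho => cumulativeIsolation_of_covIL hCovIL n w A o j hA ho

end Summit.CriticalPhenomena.PercolationContinuityZ3.Theorems

end
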